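import Summits.CriticalPhenomena.PercolationContinuityZ3.Theorems.SahiLiebSahiContinuum

/-!
# Lieb–Sahi's continuous conjecture on `Q_d` is a statement about `n` increasing Borel sets
# (cell `prim-sahi`, typer seat; `--supports stmt-CriticalPhenomena-4575`)

Lieb–Sahi [LiebSahi2021, Lemma 2.2] reduce their Conjecture 1.1 for functions to characteristic functions of
monotone sets by multilinearity ("layer cake").  For the tree's obligation `LiebSahiContinuum d n` (Lebesgue measure
on the unit cube `Q_d = (Fin d → [0,1])`, nonnegative monotone families, `E_n ≥ 0`) we prove the events form WITHOUT
measure-level multilinearity, through the discretisation already in the tree: events form on `Q_d` ⇒ events form on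
every uniform box `[m+1]^d` (pull grid up-sets back along the monotone measurable cell map,
`LebesgueCube.sahiE_cubeWeight_eq_msahiE`) ⇒ functions form on every box (`sahiPositive_iff_indicators`, the finite
layer cake) ⇒ `LiebSahiContinuum d n` (`LebesgueCube.mSahiPositive_volume_iff_cubeWeight`).

* `liebSahiContinuum_iff_upperEvents` — `LiebSahiContinuum d n ↔` for all increasing MEASURABLE `U_0,…,U_{n−1} ⊆ Q_d`,
  `0 ≤ E_n(1_{U_0},…,1_{U_{n−1}})` (Lebesgue);
* `liebSahiContinuum_iff_lowerEvents` — the same with decreasing measurable events (Lieb–Sahi's orientation; reflection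
  `x ↦ 1 − x`).

Heads are `↔` between an OPEN obligation and its events form; nothing asserts `LiebSahiContinuum d n` (`d, n ≥ 3`).
No new definitions.  Axioms standard.
-/

noncomputable section

namespace Summit.CriticalPhenomena.PercolationContinuityZ3.Theorems

open MeasureTheory Finset Literature.Combinatorics.Sahi2008
open scoped unitInterval BigOperators

/-- The indicator of an increasing subset of a preorder is increasing (plumbing). [folklore] -/
private theorem monotone_indicator_one_of_isUpperSet' {α : Type*} [Preorder α] {A : Set α} (hA : IsUpperSet A) :
    Monotone (A.indicator (1 : α → ℝ)) := by
  intro x y hxy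
  by_cases hx : x ∈ A
  · simp [hx, hA hxy hx]
  · have h0 : (0 : ℝ) ≤ A.indicator 1 y := Set.indicator_nonneg (fun _ _ => zero_le_one) y
    simpa [hx] using h0

/-- The indicator of a decreasing subset of a preorder is decreasing (plumbing). [folklore] -/
private theorem antitone_indicator_one_of_isLowerSet' {α : Type*} [Preorder α] {A : Set α} (hA : IsLowerSet A) :
    Antitone (A.indicator (1 : α → ℝ)) := by
  intro x y hxy
  by_cases hy : y ∈ A
  · simp [hy, hA hxy hy]
  · have h0 : (0 : ℝ) ≤ A.indicator 1 x := Set.indicator_nonneg (fun _ _ => zero_le_one) x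
    simpa [hy] using h0

/-- **Lieb–Sahi's continuous conjecture ⟺ its form for increasing Borel events.**  For every `d, n`:
`LiebSahiContinuum d n` holds iff `0 ≤ E_n(1_{U_0},…,1_{U_{n−1}})` (Lebesgue measure on `Q_d`) for all increasing
measurable `U_0,…,U_{n−1} ⊆ Q_d`.  (`⇐` through the uniform boxes: a grid family of up-set indicators is the
pull-back of measurable up-sets of `Q_d` along the cell map, then the finite layer cake `sahiPositive_iff_indicators`
and `LebesgueCube.mSahiPositive_volume_iff_cubeWeight`.) [cite: LiebSahi2021, Lemma 2.2 and Conj. 1.1; LiebSahi2021, Lemma 3.8] -/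
theorem liebSahiContinuum_iff_upperEvents (d n : ℕ) :
    LiebSahiContinuum d n ↔ ∀ U : Fin n → Set (Fin d → I), (∀ k, IsUpperSet (U k)) →
      (∀ k, MeasurableSet (U k)) → 0 ≤ msahiE (volume : Measure (Fin d → I)) n (fun k => (U k).indicator 1) := by
  rw [liebSahiContinuum_iff_mSahiPositive]
  constructor
  · intro h U hU _
    exact h _ (fun k x => Set.indicator_nonneg (fun _ _ => zero_le_one) x)
      fun k => monotone_indicator_one_of_isUpperSet' (hU k)
  · intro h
    rw [LebesgueCube.mSahiPositive_volume_iff_cubeWeight]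
    intro m
    classical
    rw [sahiPositive_iff_indicators]
    intro A hA
    rw [LebesgueCube.sahiE_cubeWeight_eq_msahiE]
    have e : (fun i => setInd (A i) ∘ LebesgueCube.cubeCell m) =
        fun i => (LebesgueCube.cubeCell (d := d) m ⁻¹' ((A i : Finset (Fin d → Fin (m + 1))) :
          Set (Fin d → Fin (m + 1)))).indicator (1 : (Fin d → I) → ℝ) := by
      funext i x
      simp only [Function.comp_apply, setInd_apply, Set.indicator_apply, Set.mem_preimage, Finset.mem_coe,
        Pi.one_apply]
    rw [e]
    exact h _ (fun i => (hA i).preimage (LebesgueCube.cubeCell_mono m))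
      fun i => LebesgueCube.measurable_cubeCell m MeasurableSet.of_discrete

/-- **Lieb–Sahi's continuous conjecture ⟺ its form for decreasing Borel events** (the printed orientation):
`LiebSahiContinuum d n` iff `0 ≤ E_n(1_{D_0},…,1_{D_{n−1}})` for all decreasing measurable `D_0,…,D_{n−1} ⊆ Q_d`
(reflect every coordinate, `x ↦ 1 − x`, a measure-preserving order-reversing bijection of `Q_d`).
[cite: LiebSahi2021, Lemma 2.2, Conj. 1.1 and §2 (change of variables `x_i ↦ 1 − x_i`)] -/
theorem liebSahiContinuum_iff_lowerEvents (d n : ℕ) :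
    LiebSahiContinuum d n ↔ ∀ D : Fin n → Set (Fin d → I), (∀ k, IsLowerSet (D k)) →
      (∀ k, MeasurableSet (D k)) → 0 ≤ msahiE (volume : Measure (Fin d → I)) n (fun k => (D k).indicator 1) := by
  constructor
  · intro h D hD _
    exact h _ (fun k x => Set.indicator_nonneg (fun _ _ => zero_le_one) x)
      fun k => antitone_indicator_one_of_isLowerSet' (hD k)
  · intro h
    rw [liebSahiContinuum_iff_upperEvents]
    intro U hU hUm
    -- reflect: `R x = (1 − x_j)_j`
    set R : (Fin d → I) → (Fin d → I) := fun x j => unitInterval.symm (x j) with hR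
    have hmp : MeasurePreserving R volume volume :=
      volume_preserving_pi fun _ => unitInterval.measurePreserving_symm
    have hme : MeasurableEmbedding R :=
      (MeasurableEquiv.piCongrRight fun _ : Fin d => unitInterval.symmMeasurableEquiv).measurableEmbedding
    have hRanti : ∀ x y : Fin d → I, x ≤ y → R y ≤ R x := fun x y hxy j => unitInterval.symm_le_symm.2 (hxy j)
    rw [← msahiE_comp_measurePreserving hmp hme n]
    have e : (fun k => (U k).indicator (1 : (Fin d → I) → ℝ) ∘ R) = fun k => (R ⁻¹' U k).indicator 1 := by
      funext k x
      by_cases hx : R x ∈ U k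
      · rw [Function.comp_apply, Set.indicator_of_mem hx, Set.indicator_of_mem (Set.mem_preimage.2 hx),
          Pi.one_apply, Pi.one_apply]
      · rw [Function.comp_apply, Set.indicator_of_notMem hx,
          Set.indicator_of_notMem fun h' => hx (Set.mem_preimage.1 h')]
    rw [e]
    exact h _ (fun k x y hxy hy => hU k (hRanti y x hxy) hy) fun k => hme.measurable (hUm k)

end Summit.CriticalPhenomena.PercolationContinuityZ3.Theorems
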